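import Summits.BirchSwinnertonDyer.BirchSwinnertonDyer.Theorems.UniversalToricDescentTwinAlgMuZeroAtThreeHeegnerUnitPairs
import Literature.NumberTheory.EllipticCurves.AnticyclotomicPConverseLinks
import Summits.BirchSwinnertonDyer.Rank1Residual.X11b.BDPRouteLocalIndexTorsion
import Literature.NumberTheory.EllipticCurves.TamagawaNeZeroProofs
import HarnessLib

/-!
# Route `UniversalToricDescent`, crux `TwinAlgMuZeroAtThree` (stmt-BirchSwinnertonDyer-24737, R2 text): its conclusion
# at a UNIT HEEGNER PAIR — `ord₃ log_ω y_K = 1` and `3 ∤ ∏_w c_w(W′/K)` — GRANTED Gross 1991 Prop. 2.1 (cited predicate)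

Width prover `bsd-wall-utd-p1-w2` g8 (cell `bsd-wall`), `--supports stmt-BirchSwinnertonDyer-24737`. THEOREMS ONLY (no
definition, no named fact minted, no `sorry`). Sequel of `…TwinAlgMuZeroAtThreeHeegnerUnitPairs` (§1–§3 there: the
conclusion at a `3`-indivisible Heegner point of log order one, granted `Gross1991_prop_2_1`).

* §4 `ord₃ log_ω P = 1` ALONE gives `P` of infinite order (`padicLogOrd_le_zero_of_isOfFinAddOrder`: torsion ⟹
  `ord ≤ 0`) and `3 ∤ P` in `W′(K)` (`two_le_padicLogOrd_smul`: along X11b's coordinate `Ψ`, `ord₃ log_ω (3 • Q) ≥ 2`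
  when `3 ∤ c₃ · #W̃′_ns(𝔽₃)`; `not_exists_smul_eq_of_padicLogOrd_eq_one`);
* §5 **`twinAlgMu_at_unitHeegnerPair_mult_of_gross21` / `…_goodSS_of_gross21`**: the same conclusion from the TWO
  numerics of the census's unit pairs only — `ord₃ log_ω y_K = 1` and `3 ∤ ∏_w c_w(W′/K)` — granted `Gross1991_prop_2_1`.

HONEST FRAMING: per-pair theorems (tier U), CONDITIONAL on the displayed cited predicate `Gross1991_prop_2_1 N′ W′ K`
(Kolyvagin at `p = 3`; in the tree reduced to `Gross1991_kolyvaginClasses ∧ Gross1991_prop_8_2`); the remaining per-pair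
inputs are the two numerics of the census's unit pairs (`ord₃ log_ω y_K = 1`, `3 ∤ ∏ c_w`) and, on C₀, non-CM. They do
NOT close the ∀-item 24737; no class count moves; BSD is proved for no curve by this file.

References: [GrossLMS1991] §2 Prop. 2.1; [JetchevSkinnerWan2017] Prop. 3.2.1, (7.1.5); [SilvermanAEC2009] IV.6.4,
VII.2.2, VII.6.1–6.2; [MilneADT2006] I Thm. 2.8, Thm. 4.10 (b).
-/

set_option linter.dupNamespace false
set_option autoImplicit false

noncomputable section

open scoped Classical

open NumberField IsDedekindDomain Field
open Literature.NumberTheory.EllipticCurves Literature.NumberTheory.EllipticCurves.GreenbergSelmer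
open Literature.NumberTheory.GaloisRepresentations

namespace Summit.BirchSwinnertonDyer.BirchSwinnertonDyer.Theorems.UniversalToricDescentTwinAlgMuUnitPairs

open Summit.BirchSwinnertonDyer.Rank1Residual.X11b
open Summit.BirchSwinnertonDyer.Rank1Residual.X11b.AcSelmer
open Summit.BirchSwinnertonDyer.Rank1Residual.X11b.Halves
open Literature.NumberTheory.EllipticCurves.Rank1Residual
open Summit.BirchSwinnertonDyer.BirchSwinnertonDyer.Theorems.UniversalToricDescentTwinSplit.VanishingControl

/-! ## §4 `ord_p log_ω P = 1` alone: `P` has infinite order and is NOT `p`-divisible in `W(K)` -/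

section LogOrder

variable (W : WeierstrassCurve ℚ) [W.IsElliptic] [W.IsGloballyMinimal] (p : ℕ) [Fact p.Prime]
  {K : Type} [Field K] [NumberField K]

/-- **A torsion point has `ord_p log_ω P ≤ 0`** (the tree's `padicLogOrd` is `v(log(m₀ • P_ι)) − v_p(m₀)` and the
logarithm of a torsion point is `0`, `padicLogPoint_formalIndex_smul_eq_zero_of_isOfFinAddOrder`; `v(0) = 0`). Hence
`ord_p log_ω P = 1` forces `P` to have infinite order. [cite: SilvermanAEC2009, IV.6.4 and VII.2.2] -/
theorem padicLogOrd_le_zero_of_isOfFinAddOrder (ι : K →+* ℚ_[p]) {P : (W.baseChange K).toAffine.Point}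
    (hP : IsOfFinAddOrder P) : Literature.NumberTheory.EllipticCurves.padicLogOrd W p ι P ≤ 0 := by
  unfold Literature.NumberTheory.EllipticCurves.padicLogOrd
  rw [Literature.NumberTheory.EllipticCurves.AcPConverseLinks.padicLogPoint_formalIndex_smul_eq_zero_of_isOfFinAddOrder W p ι hP, Padic.valuation_zero]
  have h0 : (0 : ℤ) ≤ (padicValNat p (Literature.NumberTheory.EllipticCurves.formalIndex W p) : ℤ) := Int.natCast_nonneg _
  omega

/-- **`ord_p log_ω (p • Q) ≥ 2`** for `Q ∈ W(K)` with `Q_ι` of infinite order, when `p ∤ c_p(W)` and `p ∤ #W̃_ns(𝔽_p)`: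
along X11b's coordinate `Ψ : W(ℚ_p) → ℤ_p` (`v(Ψ R_ι) = ord_p log_ω R + v_p(c_p) + v_p(#W̃_ns) − 1`,
`LocalIndex.exists_addEquiv_valuation_psi_padicPointOf`) one has `v(Ψ(p • Q_ι)) = 1 + v(Ψ Q_ι) ≥ 1`.
[cite: SilvermanAEC2009, IV.6.4, VII.2.2, VII.6.1] [cite: JetchevSkinnerWan2017, (7.1.5)] -/
theorem two_le_padicLogOrd_smul (ι : K →+* ℚ_[p])
    (hc : ¬ p ∣ (W.baseChange ℚ_[p]).localTamagawaNumber ℤ_[p]) (hred : ¬ p ∣ W.reductionPointCount p)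
    {Q : (W.baseChange K).toAffine.Point} (hQ : ¬ IsOfFinAddOrder (Summit.BirchSwinnertonDyer.Rank1Residual.X11b.padicPointOf W p ι Q)) :
    2 ≤ Literature.NumberTheory.EllipticCurves.padicLogOrd W p ι (p • Q) := by
  haveI : ((W.baseChange ℚ_[p]).formalFiltration 2).FiniteIndex :=
    (W.baseChange ℚ_[p]).finiteIndex_formalFiltration 2
  obtain ⟨φ, hφ⟩ := LocalIndex.exists_addEquiv_valuation_psi_padicPointOf W p (K := K)
  have hmap : Summit.BirchSwinnertonDyer.Rank1Residual.X11b.padicPointOf W p ι (p • Q) = (p : ℤ) • Summit.BirchSwinnertonDyer.Rank1Residual.X11b.padicPointOf W p ι Q + 0 := by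
    unfold Summit.BirchSwinnertonDyer.Rank1Residual.X11b.padicPointOf
    rw [map_nsmul, natCast_zsmul, add_zero]
  have hpQ : ¬ IsOfFinAddOrder (Summit.BirchSwinnertonDyer.Rank1Residual.X11b.padicPointOf W p ι (p • Q)) := by
    intro h
    rw [hmap, add_zero, natCast_zsmul] at h
    exact hQ (h.of_nsmul (Fact.out : p.Prime).ne_zero)
  have hval := hφ ι (p • Q) hpQ
  have hpsi : (LocalIndex.psi ((W.baseChange ℚ_[p]).formalFiltration 2) φ (Summit.BirchSwinnertonDyer.Rank1Residual.X11b.padicPointOf W p ι (p • Q))).valuation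
      = padicValNat p (p : ℤ).natAbs +
        (LocalIndex.psi ((W.baseChange ℚ_[p]).formalFiltration 2) φ (Summit.BirchSwinnertonDyer.Rank1Residual.X11b.padicPointOf W p ι Q)).valuation := by
    rw [hmap]
    exact LocalIndex.valuation_psi_zsmul_add ((W.baseChange ℚ_[p]).formalFiltration 2) φ hQ
      IsOfFinAddOrder.zero (by exact_mod_cast (Fact.out : p.Prime).ne_zero)
  have hvp : padicValNat p (p : ℤ).natAbs = 1 := by
    rw [Int.natAbs_natCast]; exact padicValNat_self
  rw [padicValNat.eq_zero_of_not_dvd hc, padicValNat.eq_zero_of_not_dvd hred, hpsi, hvp] at hval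
  have h0 : (0 : ℤ) ≤
      ((LocalIndex.psi ((W.baseChange ℚ_[p]).formalFiltration 2) φ (Summit.BirchSwinnertonDyer.Rank1Residual.X11b.padicPointOf W p ι Q)).valuation : ℤ) :=
    Int.natCast_nonneg _
  have hdef : Literature.NumberTheory.EllipticCurves.padicLogOrd W p ι (p • Q) = Summit.BirchSwinnertonDyer.Rank1Residual.X11b.padicLogOrd W p ι (p • Q) := rfl
  rw [hdef]
  push_cast at hval
  omega

/-- **`ord_p log_ω P = 1` ⟹ `P` has infinite order and is not `p`-divisible in `W(K)`** (when `p ∤ c_p(W)` and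
`p ∤ #W̃_ns(𝔽_p)`): a `p`-divisible non-torsion point has `ord_p log ≥ 2`, a torsion one `≤ 0`.
[cite: SilvermanAEC2009, IV.6.4 and VII.2.2] -/
theorem not_exists_smul_eq_of_padicLogOrd_eq_one (ι : K →+* ℚ_[p])
    (hc : ¬ p ∣ (W.baseChange ℚ_[p]).localTamagawaNumber ℤ_[p]) (hred : ¬ p ∣ W.reductionPointCount p)
    {P : (W.baseChange K).toAffine.Point} (hlog : Literature.NumberTheory.EllipticCurves.padicLogOrd W p ι P = 1) :
    ¬ IsOfFinAddOrder P ∧ ¬ ∃ Q : (W.baseChange K).toAffine.Point, p • Q = P := by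
  have hPinf : ¬ IsOfFinAddOrder P := fun h ↦ by
    have := padicLogOrd_le_zero_of_isOfFinAddOrder W p ι h
    omega
  refine ⟨hPinf, ?_⟩
  rintro ⟨Q, rfl⟩
  have hQ : ¬ IsOfFinAddOrder (Summit.BirchSwinnertonDyer.Rank1Residual.X11b.padicPointOf W p ι Q) := by
    intro h
    apply hPinf
    have h' : IsOfFinAddOrder (Summit.BirchSwinnertonDyer.Rank1Residual.X11b.padicPointOf W p ι (p • Q)) := by
      unfold Summit.BirchSwinnertonDyer.Rank1Residual.X11b.padicPointOf at h ⊢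
      rw [map_nsmul]
      exact h.nsmul
    exact (WeierstrassCurve.Affine.Point.map_injective (W' := W) ι.toRatAlgHom).isOfFinAddOrder_iff.mp h'
  have := two_le_padicLogOrd_smul W p ι hc hred hQ
  omega

end LogOrder

/-! ## §5 The UNIT-HEEGNER-PAIR form: only `ord₃ log_ω y_K = 1` and `3 ∤ ∏ c_w`, GRANTED Gross 1991 Prop. 2.1 -/

/-- `3 ∤ ∏_w c_w(W/K)` with `3` split in the imaginary quadratic `K` ⟹ `3 ∤ c₃(W/ℚ₃)` (the two places above `3`
each contribute `c₃(W/ℚ₃)`: `v₃(∏_{w∣3} c_w) = 2·v₃(c₃)`, tree `padicValNat_tamagawaProductAbove_eq_two_mul`; `c₃ ≠ 0`).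
[cite: SilvermanAEC2009, VII.6 Cor. 6.2] -/
theorem not_dvd_localTamagawaNumber_padic_of_not_dvd_tamagawaProduct {K : Type} [Field K] [NumberField K]
    (W : WeierstrassCurve ℚ) [W.IsElliptic] [W.IsGloballyMinimal] (p : ℕ) [Fact p.Prime]
    (hK : IsImaginaryQuadratic K) (hsplit : SplitsIn K p)
    (htam : ¬ p ∣ (W.baseChange K).tamagawaProduct) :
    ¬ p ∣ (W.baseChange ℚ_[p]).localTamagawaNumber ℤ_[p] := by
  intro h
  have hne : (W.baseChange ℚ_[p]).localTamagawaNumber ℤ_[p] ≠ 0 :=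
    WeierstrassCurve.localTamagawaNumber_padic_ne_zero_holds p (W.baseChange ℚ_[p])
  have h1 : 1 ≤ padicValNat p ((W.baseChange ℚ_[p]).localTamagawaNumber ℤ_[p]) :=
    one_le_padicValNat_of_dvd hne h
  have h2 := LocalIndexTransport.padicValNat_tamagawaProductAbove_eq_two_mul W K p
    (IsImaginaryQuadratic.finrank_eq_two hK) hsplit
  have h3 : 1 ≤ padicValNat p (tamagawaProductAbove W K p) := by rw [h2]; omega
  exact htam ((dvd_of_one_le_padicValNat h3).trans (tamagawaProductAbove_dvd_tamagawaProduct W K p))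

/-- **Bucket B at a UNIT HEEGNER PAIR, GRANTED Gross 1991 Prop. 2.1: the conclusion of `TwinAlgMuZeroAtThree` (item
24737) at `(W′, K, κ, γ, 𝔭′)`** — `W′/ℚ` multiplicative at `3` (très ramifié or non-split) with `ρ̄_{W′,3}` onto and
conductor `N′`; `K` imaginary quadratic Heegner for `N′`, `d_K` odd; any `ℤ₃`-extension `κ` with topological generator
`γ`; a degree-one `𝔭′ ∣ 3`; a Heegner point `y_K ∈ W′(K)` with **`ord₃ log_ω y_K = 1` at `𝔭′`** and **`3 ∤ ∏_w c_w(W′/K)`**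
(the two numerics of the census's unit pairs). `3 ∤ y_K` in `W′(K)` and the infinite order of `y_K` FOLLOW (§4); Kolyvagin
(`Gross1991_prop_2_1 N′ W′ K`, displayed) gives rank one and `Ш[3] = 0`; X11b's exact count + vanishing control finish.
CONDITIONAL on the displayed predicate only; BSD is not proved by this. [cite: GrossLMS1991, §2 Prop. 2.1]
[cite: JetchevSkinnerWan2017, Prop. 3.2.1 and (7.1.5)] [cite: GreenbergLNM1716, §3 Lemma 3.3, §4] -/
theorem twinAlgMu_at_unitHeegnerPair_mult_of_gross21 (K : Type) [Field K] [NumberField K]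
    (W' : WeierstrassCurve ℚ) [W'.IsElliptic] [W'.IsGloballyMinimal] (N' : ℕ) [NeZero N']
    (h21 : Gross1991_prop_2_1 N' W' K)
    (hm : Mult W' 3)
    (hside : ¬ W'.HasSplitMultiplicativeReductionAtPrime 3 ∨
      ¬ 3 ∣ padicValInt 3 W'.minimalDiscriminantInt)
    (hsurj : W'.HasSurjectiveModNGaloisRep 3) (hN' : W'.conductorNorm ℤ = N')
    (hK : IsImaginaryQuadratic K) (hH : SatisfiesHeegnerHypothesis N' K) (hodd : Odd (NumberField.discr K))
    (κ : ZpExtension K 3) (γ : absoluteGaloisGroup K) [Fact (κ.IsTopGenerator γ)]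
    (𝔭' : HeightOneSpectrum (𝓞 K)) (h𝔭' : ((3 : ℕ) : 𝓞 K) ∈ 𝔭'.asIdeal)
    (he' : 𝔭'.asIdeal.ramificationIdx (𝓞 ℚ) = 1) (hf' : 𝔭'.asIdeal.inertiaDeg (𝓞 ℚ) = 1)
    (P : (W'.baseChange K).toAffine.Point) (hP : IsHeegnerPoint N' W' K P)
    (hlog : Literature.NumberTheory.EllipticCurves.padicLogOrd W' 3 (embAt K 3 𝔭' h𝔭' he' hf') P = 1)
    (htam : ¬ 3 ∣ (W'.baseChange K).tamagawaProduct) :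
    Module.IsTorsion (IwasawaAlgebra 3) (XAc (W'.baseChange K) 3 κ 𝔭' ∅ γ) ∧
      ∃ g' : UnrSeries 3,
        (XAc.charIdeal (W'.baseChange K) 3 κ 𝔭' ∅ γ).map (PowerSeries.map (toUnr 3)) = Ideal.span {g'} ∧
          ∃ i : ℕ, ‖((PowerSeries.coeff i g' : unrIntegers 3) : ℂ_[3])‖ = 1 := by
  have hsplit : SplitsIn K 3 := hH 3 Nat.prime_three (hN' ▸ dvd_conductorNorm_of_mult hm)
  have hc := not_dvd_localTamagawaNumber_padic_of_not_dvd_tamagawaProduct W' 3 hK hsplit htam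
  have hred : ¬ 3 ∣ W'.reductionPointCount 3 :=
    Summit.BirchSwinnertonDyer.Rank1Residual.X11b.LocalTorsion.not_dvd_reductionPointCount_of_mult W' 3 hm
  obtain ⟨-, hndiv⟩ := not_exists_smul_eq_of_padicLogOrd_eq_one W' 3 (embAt K 3 𝔭' h𝔭' he' hf') hc hred hlog
  exact twinAlgMu_at_heegnerPoint_mult_of_gross21 K W' N' h21 hm hside hsurj hN' hK hH hodd κ γ 𝔭' h𝔭' he' hf'
    P hP hndiv hlog htam

/-- **Bucket C₀ at a UNIT HEEGNER PAIR, GRANTED Gross 1991 Prop. 2.1: the conclusion of `TwinAlgMuZeroAtThree` (item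
24737) at `(W′, K, κ, γ, 𝔭′)`** — non-CM `W′/ℚ` good supersingular at `3` with `ρ̄_{W′,3}` onto and conductor `N′`; `K`
imaginary quadratic Heegner for `N′`, `d_K` odd; `κ`, `γ`; a degree-one `𝔭′ ∣ 3`; a Heegner point `y_K` with
**`ord₃ log_ω y_K = 1` at `𝔭′`** and **`3 ∤ ∏_w c_w(W′/K)`**. CONDITIONAL on the displayed predicate only; BSD is not proved by
this. [cite: GrossLMS1991, §2 Prop. 2.1] [cite: JetchevSkinnerWan2017, Prop. 3.2.1 and (7.1.5)] [cite: Kim2022StructureSelmer, §3.1.1] -/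
theorem twinAlgMu_at_unitHeegnerPair_goodSS_of_gross21 (K : Type) [Field K] [NumberField K]
    (W' : WeierstrassCurve ℚ) [W'.IsElliptic] [W'.IsGloballyMinimal] (N' : ℕ) [NeZero N']
    (h21 : Gross1991_prop_2_1 N' W' K) (hncm : ¬ W'.HasCM)
    (hss : GoodSS W' 3) (hsurj : W'.HasSurjectiveModNGaloisRep 3)
    (hK : IsImaginaryQuadratic K) (hH : SatisfiesHeegnerHypothesis N' K) (hodd : Odd (NumberField.discr K))
    (κ : ZpExtension K 3) (γ : absoluteGaloisGroup K) [Fact (κ.IsTopGenerator γ)]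
    (𝔭' : HeightOneSpectrum (𝓞 K)) (h𝔭' : ((3 : ℕ) : 𝓞 K) ∈ 𝔭'.asIdeal)
    (he' : 𝔭'.asIdeal.ramificationIdx (𝓞 ℚ) = 1) (hf' : 𝔭'.asIdeal.inertiaDeg (𝓞 ℚ) = 1)
    (P : (W'.baseChange K).toAffine.Point) (hP : IsHeegnerPoint N' W' K P)
    (hlog : Literature.NumberTheory.EllipticCurves.padicLogOrd W' 3 (embAt K 3 𝔭' h𝔭' he' hf') P = 1)
    (htam : ¬ 3 ∣ (W'.baseChange K).tamagawaProduct) :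
    Module.IsTorsion (IwasawaAlgebra 3) (XAc (W'.baseChange K) 3 κ 𝔭' ∅ γ) ∧
      ∃ g' : UnrSeries 3,
        (XAc.charIdeal (W'.baseChange K) 3 κ 𝔭' ∅ γ).map (PowerSeries.map (toUnr 3)) = Ideal.span {g'} ∧
          ∃ i : ℕ, ‖((PowerSeries.coeff i g' : unrIntegers 3) : ℂ_[3])‖ = 1 := by
  have hsplit : SplitsIn K 3 := by
    have h := (splitsIn_primesEquiv_under_iff (IsImaginaryQuadratic.finrank_eq_two hK) 𝔭').mpr
      ⟨he', hf'⟩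
    rwa [under_eq_ratPlace_of_mem h𝔭', primesEquiv_ratPlace] at h
  have hc := not_dvd_localTamagawaNumber_padic_of_not_dvd_tamagawaProduct W' 3 hK hsplit htam
  have hred : ¬ 3 ∣ W'.reductionPointCount 3 := not_dvd_reductionPointCount_of_goodSS W' hss
  obtain ⟨-, hndiv⟩ := not_exists_smul_eq_of_padicLogOrd_eq_one W' 3 (embAt K 3 𝔭' h𝔭' he' hf') hc hred hlog
  exact twinAlgMu_at_heegnerPoint_goodSS_of_gross21 K W' N' h21 hncm hss hsurj hK hH hodd κ γ 𝔭' h𝔭' he' hf'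
    P hP hndiv hlog htam

end Summit.BirchSwinnertonDyer.BirchSwinnertonDyer.Theorems.UniversalToricDescentTwinAlgMuUnitPairs

end
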